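import Summits.MatrixMultiplication.OmegaCensus.STPPVosperSlackOneCoverLawA2
import Summits.MatrixMultiplication.OmegaCensus.STPPVosperCover235RowsG
import Summits.MatrixMultiplication.OmegaCensus.STPPVosperCover235RowsA29
import Summits.MatrixMultiplication.OmegaCensus.STPPVosperCover235RowsA30
import Summits.MatrixMultiplication.OmegaCensus.STPPVosperCover235RowsBrest
import Summits.MatrixMultiplication.OmegaCensus.STPPHamidouneRodsethInverseTheorem

/-!
# ω-census (abelian STPP census): `{(2,3,5),(2,3,5)}` has no STPP family in `ℤ/59ℤ` — UNCONDITIONAL kernel kill by the slack-1 cover law (kernel)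

HONEST FRAMING (pub-omega census; verbatim): lottery ticket; floor = certified bounds/negative ranges.
Census STRUCTURE (seat pub-omega-stpp-2 gen 25, 2026-08-28; leaf assigned by RULINGS L36-101/103), family (b2).  The pattern `{(2,3,5),(2,3,5)}`
(`2·30 = 60 > 59`) is a leaf of the `ℤ₅₉` residual front of record left open by the window-table laws of stpp-1 g29/g30: in the reading `(a,b,c) = (2,3,5)`
at block `0` (`(z,L,vol,m,n) = (10,15,30,16,46)`, slack one) every case has the survivors `29, 30 = ±2⁻¹` (case α₂ also `±5`).  Here all of them die at the
EXACT-COVER STAGE: the single other block `(2,3,5)` cannot realise `C − B = Y°` and `C − A = Z°` for any of the rigid shapes — case γ: `Y°` the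
`15`-progression, `Z°` the `11`-progression minus one term (`11` shapes per ratio); case α₂: `Y°` two runs (`8` offsets per `(j, ℓ₁)`, `ℓ₁ ≤ 7`), `Z°` the
`10`-run; case β: `Y°` the progression, `Z°` the `10`-run or the `9`-run plus an end-adjacent point.  Searches: `coverSearch` (`STPPVosperCoverSearch.lean`)
run Z-first (`cover_both_of_isSTPP`), ≈ 2.5 s each, in `STPPVosperCover235Rows{G,A29,A30,B3,B56,B2039,Bmid,Brest}.lean`.  Law: `no_isSTPP_of_slack_one_cover_prime_a2`
(`STPPVosperSlackOneCoverLawA2.lean`) with `hamidouneRodsethInverseTheorem_holds` — UNCONDITIONAL.  Independent python pilots (plain cover, two code-disjoint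
mirrors: HOME `pub-omega-stpp-2-g25/code/pilot/`, stpp-1 g31 `kit/slack1-cover-pilot/`) agree that no cover exists in this reading.  Nothing here is progress
on `ω`.

References: H. Cohn, R. Kleinberg, B. Szegedy, C. Umans, FOCS 2005 (arXiv:math/0511460), Def. 5.1; A. G. Vosper, J. London Math. Soc. 31 (1956);
Y. O. Hamidoune, Ø. J. Rødseth, Acta Arith. 92 (2000) 251–262.
-/

open Finset
open scoped Pointwise

namespace Summit.MatrixMultiplication.OmegaCensus.CubeNB

open Literature.Computability.AlgebraicComplexity
open Literature.Combinatorics.Additive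
open Summit.MatrixMultiplication.OmegaCensus.STPPKneser

/-! ## Tables -/

section Tables

/-- Tight-type (case γ) window table `(n, m, b) = (46, 16, 3)` at `59`: admissible ratios are words `0, ±1, ±2` or the survivors `29, 30`. [folklore] -/
theorem table59_46_16_3 : ∀ j < 59, ∀ t < 59, (∀ i' < 16, (t + j * i') % 59 < 46) →
    (∀ k < 16, 3 ∣ (t + j * k) % 59 - #((range 16).filter fun i' => (t + j * i') % 59 < (t + j * k) % 59)) →
    j ∈ ({0, 1, 58, 2, 57, 29, 30} : Finset ℕ) := by
  decide +kernel

/-- Case-β table `(n+1, m, b) = (47, 16, 3)` at `59`: survivors `29, 30` beyond the words. [folklore] -/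
theorem tableB59_47_16_3 : tableBeta 59 47 16 3 {0, 1, 58, 2, 57, 29, 30} = true := by
  decide +kernel

/-- The word target at `59` for `(a, b) = (2, 3)`: `0`, `±1`, `±2`. [folklore] -/
theorem words59_2_3 : ∀ jv ∈ ({0, 1, 58, 2, 57} : Finset ℕ),
    jv = 0 ∨ (∃ k ∈ range 3, 1 ≤ k ∧ (jv = k ∨ jv + k = 59)) ∨ (∃ k ∈ range 2, 1 ≤ k ∧ (jv * k % 59 = 1 ∨ jv * k % 59 = 59 - 1)) := by
  decide

/-- Split of the γ target: words, or (`j = 29, 30`) the failed searches of `STPPVosperCover235RowsG.lean`. [folklore] -/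
theorem split59_235_gamma : ∀ jv ∈ ({0, 1, 58, 2, 57, 29, 30} : Finset ℕ),
    (jv = 0 ∨ (∃ k ∈ range 3, 1 ≤ k ∧ (jv = k ∨ jv + k = 59)) ∨ (∃ k ∈ range 2, 1 ≤ k ∧ (jv * k % 59 = 1 ∨ jv * k % 59 = 59 - 1))) ∨
      ∀ ν < 10 + 1, coverSearch 59 ((List.range 15).map fun t => (jv * t) % 59) ((List.range (10 + 1)).filter fun t => decide (t ≠ ν)) [(2, 3, 5)] = false ∨
        coverSearch 59 ((List.range (10 + 1)).filter fun t => decide (t ≠ ν)) ((List.range 15).map fun t => (jv * t) % 59) [(3, 2, 5)] = false := by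
  intro jv hjv
  have hcases : jv ∈ ({0, 1, 58, 2, 57} : Finset ℕ) ∨ jv = 29 ∨ jv = 30 := by
    revert hjv; revert jv; decide
  rcases hcases with h | rfl | rfl
  · exact Or.inl (words59_2_3 jv h)
  · exact Or.inr cover59_235_gamma_j29
  · exact Or.inr cover59_235_gamma_j30

/-- Split of the β target: words, or (`j = 29, 30`) the failed searches of `STPPVosperCover235RowsG.lean`. [folklore] -/
theorem split59_235_beta : ∀ jv ∈ ({0, 1, 58, 2, 57, 29, 30} : Finset ℕ),
    (jv = 0 ∨ (∃ k ∈ range 3, 1 ≤ k ∧ (jv = k ∨ jv + k = 59)) ∨ (∃ k ∈ range 2, 1 ≤ k ∧ (jv * k % 59 = 1 ∨ jv * k % 59 = 59 - 1))) ∨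
      ((∀ k < 3 + 46 + 1, (2 ≤ k ∧ k + 2 ≤ 3 + 46) ∨ k = 0 ∨ k = 3 + 46 ∨
          (coverSearch 59 ((List.range 15).map fun t => (jv * t) % 59) (List.range (10 - 1) ++ [k + 10 - 1]) [(2, 3, 5)] = false ∨
            coverSearch 59 (List.range (10 - 1) ++ [k + 10 - 1]) ((List.range 15).map fun t => (jv * t) % 59) [(3, 2, 5)] = false)) ∧
        (coverSearch 59 ((List.range 15).map fun t => (jv * t) % 59) (List.range 10) [(2, 3, 5)] = false ∨
          coverSearch 59 (List.range 10) ((List.range 15).map fun t => (jv * t) % 59) [(3, 2, 5)] = false)) := by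
  intro jv hjv
  have hcases : jv ∈ ({0, 1, 58, 2, 57} : Finset ℕ) ∨ jv = 29 ∨ jv = 30 := by
    revert hjv; revert jv; decide
  rcases hcases with h | rfl | rfl
  · exact Or.inl (words59_2_3 jv h)
  · exact Or.inr cover59_235_beta_j29
  · exact Or.inr cover59_235_beta_j30

end Tables

/-! ## The kill -/

section Kill

/-- **`{(2,3,5),(2,3,5)}` has no STPP family in `ℤ/59ℤ`** — UNCONDITIONAL (slack-1 cover law for `a = 2` at block `0` in the reading `(2,3,5)`; see the
module docstring). [cite: CohnKleinbergSzegedyUmans2005, Def. 5.1] [cite: Vosper1956, main theorem; Nathanson1996, Thm 2.7]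
[cite: HamidouneRodseth2000, main theorem (§1, p. 252)] -/
theorem no_isSTPP_zmod59_235_235 (A B C : Fin 2 → Finset (ZMod 59)) (hS : IsSTPP A B C)
    (hA : ∀ i, #(A i) = ![2, 2] i) (hB : ∀ i, #(B i) = ![3, 3] i) (hC : ∀ i, #(C i) = ![5, 5] i) : False := by
  haveI : Fact (Nat.Prime 59) := ⟨by norm_num⟩
  have hAne : ∀ i, (A i).Nonempty := fun i => card_pos.1 (by rw [hA]; fin_cases i <;> simp)
  have hBne : ∀ i, (B i).Nonempty := fun i => card_pos.1 (by rw [hB]; fin_cases i <;> simp)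
  have hCne : ∀ i, (C i).Nonempty := fun i => card_pos.1 (by rw [hC]; fin_cases i <;> simp)
  have e1 : (univ : Finset (Fin 2)).erase 0 = {1} := by decide
  have hz : ∑ k ∈ (univ : Finset (Fin 2)).erase 0, #(A k) * #(C k) = 10 := by
    rw [e1, Finset.sum_singleton]; simp [hA, hC]
  have hL : ∑ k ∈ (univ : Finset (Fin 2)).erase 0, #(B k) * #(C k) = 15 := by
    rw [e1, Finset.sum_singleton]; simp [hB, hC]
  have ha : #(A 0) = 2 := by rw [hA]; simp
  have hb : #(B 0) = 3 := by rw [hB]; simp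
  have hvol : #(A 0) * #(B 0) * #(C 0) = 30 := by rw [hA, hB, hC]; simp
  have hsAB : [(2, 3, 5)] = ([1] : List (Fin 2)).map (fun k => (#(A k), #(B k), #(C k))) := by simp [hA, hB, hC]
  have hsBA : [(3, 2, 5)] = ([1] : List (Fin 2)).map (fun k => (#(B k), #(A k), #(C k))) := by simp [hA, hB, hC]
  exact no_isSTPP_of_slack_one_cover_prime_a2 hamidouneRodsethInverseTheorem_holds A B C hS hAne hBne hCne 0 ⟨1, by decide⟩
    ha hb hvol hz hL rfl (by norm_num) (by norm_num) (by norm_num) (by norm_num) (m := 16) (n := 46) rfl rfl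
    [1] (by decide) (fun k => by fin_cases k <;> decide) [(2, 3, 5)] hsAB [(3, 2, 5)] hsBA true
    (Jγ := {0, 1, 58, 2, 57, 29, 30}) (Jα := {0, 1, 58, 2, 57}) (Jβ := {0, 1, 58, 2, 57, 29, 30})
    table59_46_16_3 split59_235_gamma (a2row59_235_all a2row59_235_j29 a2row59_235_j30) words59_2_3 tableB59_47_16_3 split59_235_beta

end Kill

end Summit.MatrixMultiplication.OmegaCensus.CubeNB
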